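import Summits.CriticalPhenomena.CardyFormulaZ2.Theorems.CardyIKTransportRenewalGridHarmlessDualBlock
import Literature.Probability.Percolation.RSW

/-!
# `RenewalGridHarmless` (stmt-CriticalPhenomena-4967), sandwich step 2b: the blocking theorem

Route `CardyIKTransport`, support item `RenewalGridHarmless`; continuation of
`CardyIKTransportRenewalGridHarmlessDualBlock.lean` (chains, lattice positions, primal/dual edge
crossing, polygonal curves), which see for the overview. Here: the blocking theorem
`false_of_crossing_of_dualChain` — in a square model `Φ` of `R`, a crude crossing of `R` at mesh `δ`
(drawn as a polygonal curve `V`: chart inside the strip `|re| ≤ 1 + ν`, joining heights `-1 + ν`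
and `1 - ν`) and a dual-open chain whose face-centre positions shadow, within `ρ/2`, hypothesis
positions in the closed conjugate template `Φ([-1-ε,1+ε] × [-1+ε,1-ε])` from its right to its left
side (drawn as `H`: chart inside the band `|im| ≤ 1 - ε + 2ν`, joining `re ≥ 1 + ν` to
`re ≤ -1 - ν`) cannot coexist: `V ∩ H ≠ ∅` by the plus-position lemma through the chart
(`inter_nonempty_of_plus_chart`), and a common point forces an open edge with an open dual
(`dualEdge_eq_of_mem_segment_inter`). Also: measure bookkeeping for `P_{1/2}` (null set of non-lattice
configurations, self-duality in event form `measureReal_preimage_dualConfig`, `P(E) ≤ 1 - P(D)` when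
`E ∩ D` holds no lattice configuration) and small numerical facts used by the assembly.

References: B. Bollobás, O. Riordan, *Percolation* (2006), Ch. 3 Lemma 1, Ch. 7 Claim 19;
the tree's `PlusCrossing.lean`, `PlanarDuality.lean`.
-/

noncomputable section

namespace Summit.CriticalPhenomena.CardyFormulaZ2.Theorems.CardyIKTransport.RenewalGridHarmless

open Filter Set Metric MeasureTheory Complex
open scoped Topology
open Literature.Probability.Percolation
open Literature.Probability.LatticeModels
open Literature.Probability.RandomPlanarGeometry
open Literature.Topology.PlaneTopology

/-- A point of the segment `[p, q]` is within `dist p q` of `q`. [folklore] -/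
theorem dist_le_of_mem_segment' {p q z : ℂ} (hz : z ∈ segment ℝ p q) : dist z q ≤ dist p q := by
  have := dist_add_dist_of_mem_segment hz
  linarith [dist_nonneg (x := p) (y := z)]

/-! ### The blocking theorem -/

/-- `√2 ≤ 2`. [folklore] -/
theorem sqrt_two_le_two : Real.sqrt 2 ≤ 2 := by
  nlinarith [Real.sq_sqrt (show (0 : ℝ) ≤ 2 by norm_num), Real.sqrt_nonneg 2]

/-- Chart of a point of `R` in a square model: it lies in the open square. [folklore] -/
theorem symm_mem_square_of_mem_carrier {R : ConformalRectangle} {Φ : ℂ ≃ₜ ℂ}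
    (h : IsSquareModel R Φ) {p : ℂ} (hp : p ∈ R.carrier) :
    (Φ.symm p).re ∈ Ioo (-1 : ℝ) 1 ∧ (Φ.symm p).im ∈ Ioo (-1 : ℝ) 1 := by
  rw [← h.image_carrier, unitSquareQuad_carrier] at hp
  obtain ⟨z, hz, rfl⟩ := hp
  rw [Φ.symm_apply_apply]
  exact Complex.mem_reProdIm.1 hz

/-- Chart of a point of `R.arc 0` in a square model: the bottom side. [folklore] -/
theorem symm_mem_bottom_of_mem_arc_zero {R : ConformalRectangle} {Φ : ℂ ≃ₜ ℂ}
    (h : IsSquareModel R Φ) {p : ℂ} (hp : p ∈ R.arc 0) :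
    (Φ.symm p).im = -1 ∧ (Φ.symm p).re ∈ Icc (-1 : ℝ) 1 := by
  rw [← h.image_arc 0] at hp
  obtain ⟨z, hz, rfl⟩ := hp
  rw [Φ.symm_apply_apply]
  exact (mem_rectQuad_arc_zero (by norm_num) (by norm_num)).1 hz

/-- Chart of a point of `R.arc 2` in a square model: the top side. [folklore] -/
theorem symm_mem_top_of_mem_arc_two {R : ConformalRectangle} {Φ : ℂ ≃ₜ ℂ}
    (h : IsSquareModel R Φ) {p : ℂ} (hp : p ∈ R.arc 2) :
    (Φ.symm p).im = 1 ∧ (Φ.symm p).re ∈ Icc (-1 : ℝ) 1 := by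
  rw [← h.image_arc 2] at hp
  obtain ⟨z, hz, rfl⟩ := hp
  rw [Φ.symm_apply_apply]
  exact (mem_rectQuad_arc_two (by norm_num) (by norm_num)).1 hz

/-- Room, read on coordinates: if `dist p (Φ z) ≤ ρ` then both chart coordinates of `p` are within
`ν` of those of `z`. [folklore] -/
theorem abs_sub_le_of_room {Φ : ℂ ≃ₜ ℂ} {ρ ν : ℝ}
    (hroom : ∀ z ∈ Icc (-2 : ℝ) 2 ×ℂ Icc (-2 : ℝ) 2, ∀ p : ℂ, dist p (Φ z) ≤ ρ →
      dist (Φ.symm p) z ≤ ν)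
    {z p : ℂ} (hz : z ∈ Icc (-2 : ℝ) 2 ×ℂ Icc (-2 : ℝ) 2) (hp : dist p (Φ z) ≤ ρ) :
    |(Φ.symm p).re - z.re| ≤ ν ∧ |(Φ.symm p).im - z.im| ≤ ν := by
  have hd := hroom z hz p hp
  rw [dist_eq_norm] at hd
  exact ⟨(Complex.abs_re_le_norm (Φ.symm p - z)).trans hd,
    (Complex.abs_im_le_norm (Φ.symm p - z)).trans hd⟩

/-- **The blocking theorem** (module docstring): in a square model `Φ` of `R`, with `0 < ν`,
`4ν ≤ ε ≤ 1/2`, `ρ` a room radius of `Φ` on `[-2,2]²` at precision `ν` and a mesh `δ` with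
`2δ ≤ ρ`, a lattice configuration cannot contain both a crude crossing of `R` at mesh `δ` and a
DUAL-open chain whose face-centre positions are `ρ/2`-close to hypothesis positions lying in the
closed conjugate template `Φ([-1-ε, 1+ε] × [-1+ε, 1-ε])` and starting / ending within `ρ/2` of
its right / left sides. [folklore] -/
theorem false_of_crossing_of_dualChain {R : ConformalRectangle} {Φ : ℂ ≃ₜ ℂ}
    (h : IsSquareModel R Φ) {ε ν ρ δ : ℝ} (hν : 0 < ν) (hνε : 4 * ν ≤ ε) (hε : ε ≤ 1 / 2)
    (hroom : ∀ z ∈ Icc (-2 : ℝ) 2 ×ℂ Icc (-2 : ℝ) 2, ∀ p : ℂ, dist p (Φ z) ≤ ρ →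
      dist (Φ.symm p) z ≤ ν)
    (hδ : 0 < δ) (hδρ : 2 * δ ≤ ρ)
    {ω : BondConfig (Site 2)} (hω : ω ⊆ (zdGraph 2).edgeSet)
    (hcross : ω ∈ embDomainCrossing squareLatticeEmbedding.z R.carrier δ (R.arc 0) (R.arc 2))
    {P' : Site 2 → ℂ} {m : ℕ} {w : ℕ → Site 2}
    (hwopen : ∀ j, j < m → s(w j, w (j + 1)) ∈ dualConfig ω ∧ w j ≠ w (j + 1))
    (hwclose : ∀ j, j ≤ m → dist ((δ : ℂ) * squareLatticeEmbedding.c (w j)) (P' (w j)) ≤ ρ / 2)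
    (hwin : ∀ j, j ≤ m → (Φ.symm (P' (w j))).re ∈ Icc (-1 - ε) (1 + ε) ∧
      (Φ.symm (P' (w j))).im ∈ Icc (-1 + ε) (1 - ε))
    (hwstart : ∃ y : ℂ, (Φ.symm y).re = 1 + ε ∧ (Φ.symm y).im ∈ Icc (-1 + ε) (1 - ε) ∧
      dist (P' (w 0)) y ≤ ρ / 2)
    (hwend : ∃ y : ℂ, (Φ.symm y).re = -1 - ε ∧ (Φ.symm y).im ∈ Icc (-1 + ε) (1 - ε) ∧
      dist (P' (w m)) y ≤ ρ / 2) :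
    False := by
  have hρ : 0 ≤ ρ := by linarith
  have hδ2 : δ * Real.sqrt 2 ≤ ρ := by nlinarith [sqrt_two_le_two]
  -- the primal chain
  obtain ⟨u, hu, u', hu', hconn⟩ := mem_embDomainCrossing_iff.1 hcross
  obtain ⟨n, v, hv0, hvn, hvS, hvopen⟩ := exists_chain_of_mem_openConnIn hconn
  set p : ℕ → ℂ := fun k => (δ : ℂ) * squareLatticeEmbedding.z (v k) with hp
  have hvadj : ∀ k, k < n → (zdGraph 2).Adj (v k) (v (k + 1)) := fun k hk =>
    (SimpleGraph.mem_edgeSet _).1 (hω (hvopen k hk).1)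
  have hpstep : ∀ k, k < n → dist (p k) (p (k + 1)) ≤ ρ := fun k hk => by
    rw [hp]; simp only; rw [dist_mul_z_of_adj hδ.le (hvadj k hk)]; exact hδ2
  have hg : ∀ k, (Φ.symm (p k)).re ∈ Ioo (-1 : ℝ) 1 ∧ (Φ.symm (p k)).im ∈ Ioo (-1 : ℝ) 1 :=
    fun k => symm_mem_square_of_mem_carrier h (hvS k)
  have hgbox : ∀ k, Φ.symm (p k) ∈ Icc (-2 : ℝ) 2 ×ℂ Icc (-2 : ℝ) 2 := fun k =>
    Complex.mem_reProdIm.2 ⟨⟨by linarith [(hg k).1.1], by linarith [(hg k).1.2]⟩,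
      by linarith [(hg k).2.1], by linarith [(hg k).2.2]⟩
  -- chart bounds at the two ends of the primal chain
  have hg0 : (Φ.symm (p 0)).im ≤ -1 + ν := by
    obtain ⟨y, hy, hyd⟩ := (R.isCompact_arc 0).exists_infDist_eq_dist ⟨_, R.pt_mem_arc_self 0⟩
      ((δ : ℂ) * squareLatticeEmbedding.z u)
    obtain ⟨hyim, hyre⟩ := symm_mem_bottom_of_mem_arc_zero h hy
    have hybox : Φ.symm y ∈ Icc (-2 : ℝ) 2 ×ℂ Icc (-2 : ℝ) 2 := Complex.mem_reProdIm.2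
      ⟨⟨by linarith [hyre.1], by linarith [hyre.2]⟩, by rw [hyim]; norm_num, by rw [hyim]; norm_num⟩
    have hd : dist (p 0) (Φ (Φ.symm y)) ≤ ρ := by
      rw [Φ.apply_symm_apply, hp]; simp only; rw [hv0, ← hyd]; linarith
    have := (abs_sub_le_of_room hroom hybox hd).2
    rw [abs_le, hyim] at this; linarith [this.2]
  have hgn : 1 - ν ≤ (Φ.symm (p n)).im := by
    obtain ⟨y, hy, hyd⟩ := (R.isCompact_arc 2).exists_infDist_eq_dist ⟨_, R.pt_mem_arc_self 2⟩
      ((δ : ℂ) * squareLatticeEmbedding.z u')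
    obtain ⟨hyim, hyre⟩ := symm_mem_top_of_mem_arc_two h hy
    have hybox : Φ.symm y ∈ Icc (-2 : ℝ) 2 ×ℂ Icc (-2 : ℝ) 2 := Complex.mem_reProdIm.2
      ⟨⟨by linarith [hyre.1], by linarith [hyre.2]⟩, by rw [hyim]; norm_num, by rw [hyim]; norm_num⟩
    have hd : dist (p n) (Φ (Φ.symm y)) ≤ ρ := by
      rw [Φ.apply_symm_apply, hp]; simp only; rw [hvn, ← hyd]; linarith
    have := (abs_sub_le_of_room hroom hybox hd).2
    rw [abs_le, hyim] at this; linarith [this.1]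
  have hn : 0 < n := by
    rcases Nat.eq_zero_or_pos n with hn0 | hn0
    · exfalso; rw [hn0] at hgn; linarith
    · exact hn0
  -- the dual chain
  set q : ℕ → ℂ := fun j => (δ : ℂ) * squareLatticeEmbedding.c (w j) with hq
  have hwadj : ∀ j, j < m → (zdGraph 2).Adj (w j) (w (j + 1)) := fun j hj =>
    (SimpleGraph.mem_edgeSet _).1 ((mem_dualConfig_iff.1 (hwopen j hj).1).1)
  have hqstep : ∀ j, j < m → dist (q j) (q (j + 1)) ≤ ρ := fun j hj => by
    rw [hq]; simp only; rw [dist_mul_c_of_adj hδ.le (hwadj j hj)]; exact hδ2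
  have hP'box : ∀ j, j ≤ m → Φ.symm (P' (w j)) ∈ Icc (-2 : ℝ) 2 ×ℂ Icc (-2 : ℝ) 2 := fun j hj =>
    Complex.mem_reProdIm.2 ⟨⟨by linarith [(hwin j hj).1.1], by linarith [(hwin j hj).1.2]⟩,
      by linarith [(hwin j hj).2.1], by linarith [(hwin j hj).2.2]⟩
  have hqc : ∀ j, j ≤ m → (Φ.symm (q j)).re ∈ Icc (-1 - ε - ν) (1 + ε + ν) ∧
      (Φ.symm (q j)).im ∈ Icc (-1 + ε - ν) (1 - ε + ν) := by
    intro j hj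
    have hd : dist (q j) (Φ (Φ.symm (P' (w j)))) ≤ ρ := by
      rw [Φ.apply_symm_apply]; linarith [hwclose j hj]
    obtain ⟨hre, him⟩ := abs_sub_le_of_room hroom (hP'box j hj) hd
    rw [abs_le] at hre him
    obtain ⟨⟨h1, h2⟩, h3, h4⟩ := hwin j hj
    exact ⟨⟨by linarith [hre.1], by linarith [hre.2]⟩, by linarith [him.1], by linarith [him.2]⟩
  have hqbox : ∀ j, j ≤ m → Φ.symm (q j) ∈ Icc (-2 : ℝ) 2 ×ℂ Icc (-2 : ℝ) 2 := fun j hj =>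
    Complex.mem_reProdIm.2 ⟨⟨by linarith [(hqc j hj).1.1], by linarith [(hqc j hj).1.2]⟩,
      by linarith [(hqc j hj).2.1], by linarith [(hqc j hj).2.2]⟩
  have hq0 : 1 + ε - ν ≤ (Φ.symm (q 0)).re := by
    obtain ⟨y, hyre, hyim, hyd⟩ := hwstart
    have hybox : Φ.symm y ∈ Icc (-2 : ℝ) 2 ×ℂ Icc (-2 : ℝ) 2 := Complex.mem_reProdIm.2
      ⟨⟨by rw [hyre]; linarith, by rw [hyre]; linarith⟩, by linarith [hyim.1], by linarith [hyim.2]⟩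
    have hd : dist (q 0) (Φ (Φ.symm y)) ≤ ρ := by
      rw [Φ.apply_symm_apply]
      calc dist (q 0) y ≤ dist (q 0) (P' (w 0)) + dist (P' (w 0)) y := dist_triangle _ _ _
        _ ≤ ρ / 2 + ρ / 2 := add_le_add (hwclose 0 (Nat.zero_le m)) hyd
        _ = ρ := by ring
    have := (abs_sub_le_of_room hroom hybox hd).1
    rw [abs_le, hyre] at this; linarith [this.1]
  have hqm : (Φ.symm (q m)).re ≤ -1 - ε + ν := by
    obtain ⟨y, hyre, hyim, hyd⟩ := hwend
    have hybox : Φ.symm y ∈ Icc (-2 : ℝ) 2 ×ℂ Icc (-2 : ℝ) 2 := Complex.mem_reProdIm.2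
      ⟨⟨by rw [hyre]; linarith, by rw [hyre]; linarith⟩, by linarith [hyim.1], by linarith [hyim.2]⟩
    have hd : dist (q m) (Φ (Φ.symm y)) ≤ ρ := by
      rw [Φ.apply_symm_apply]
      calc dist (q m) y ≤ dist (q m) (P' (w m)) + dist (P' (w m)) y := dist_triangle _ _ _
        _ ≤ ρ / 2 + ρ / 2 := add_le_add (hwclose m le_rfl) hyd
        _ = ρ := by ring
    have := (abs_sub_le_of_room hroom hybox hd).1
    rw [abs_le, hyre] at this; linarith [this.2]
  have hm : 0 < m := by
    rcases Nat.eq_zero_or_pos m with hm0 | hm0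
    · exfalso; rw [hm0] at hqm; linarith
    · exact hm0
  -- the two polygonal curves are in plus position
  set a : ℝ := -1 - ν
  set b : ℝ := 1 + ν
  set c : ℝ := -1 + ε - 2 * ν
  set d : ℝ := 1 - ε + 2 * ν
  obtain ⟨z, hzV, hzH⟩ := inter_nonempty_of_plus_chart Φ (a := a) (b := b) (c := c) (d := d)
    (V := {p 0} ∪ ⋃ k ∈ Finset.range n, segment ℝ (p k) (p (k + 1)))
    (H := {q 0} ∪ ⋃ j ∈ Finset.range m, segment ℝ (q j) (q (j + 1)))
    (by simp only [a, b]; linarith) (by simp only [c, d]; linarith)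
    (isCompact_chainCurve p n) (isPreconnected_chainCurve p n)
    (by
      intro z hz
      rcases mem_chainCurve_iff.1 hz with rfl | ⟨k, hk, hzk⟩
      · exact ⟨by simp only [a]; linarith [(hg 0).1.1], by simp only [b]; linarith [(hg 0).1.2]⟩
      · have hd : dist z (Φ (Φ.symm (p (k + 1)))) ≤ ρ := by
          rw [Φ.apply_symm_apply]; exact (dist_le_of_mem_segment' hzk).trans (hpstep k hk)
        have := (abs_sub_le_of_room hroom (hgbox (k + 1)) hd).1
        rw [abs_le] at this
        exact ⟨by simp only [a]; linarith [(hg (k + 1)).1.1, this.1],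
          by simp only [b]; linarith [(hg (k + 1)).1.2, this.2]⟩)
    ⟨p 0, Or.inl rfl, by simp only [c]; linarith⟩
    ⟨p n, last_mem_chainCurve p n, by simp only [d]; linarith⟩
    (isCompact_chainCurve q m) (isPreconnected_chainCurve q m)
    (by
      intro z hz
      rcases mem_chainCurve_iff.1 hz with rfl | ⟨j, hj, hzj⟩
      · exact ⟨by simp only [c]; linarith [(hqc 0 (Nat.zero_le m)).2.1],
          by simp only [d]; linarith [(hqc 0 (Nat.zero_le m)).2.2]⟩
      · have hd : dist z (Φ (Φ.symm (q (j + 1)))) ≤ ρ := by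
          rw [Φ.apply_symm_apply]; exact (dist_le_of_mem_segment' hzj).trans (hqstep j hj)
        have := (abs_sub_le_of_room hroom (hqbox (j + 1) hj) hd).2
        rw [abs_le] at this
        exact ⟨by simp only [c]; linarith [(hqc (j + 1) hj).2.1, this.1],
          by simp only [d]; linarith [(hqc (j + 1) hj).2.2, this.2]⟩)
    ⟨q m, last_mem_chainCurve q m, by simp only [a]; linarith⟩
    ⟨q 0, Or.inl rfl, by simp only [b]; linarith⟩
  -- a common point lies on a primal and on a dual edge segment
  have hzV' : ∃ k, k < n ∧ z ∈ segment ℝ (p k) (p (k + 1)) := by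
    rcases mem_chainCurve_iff.1 hzV with rfl | h'
    · exact ⟨0, hn, left_mem_segment ℝ _ _⟩
    · exact h'
  have hzH' : ∃ j, j < m ∧ z ∈ segment ℝ (q j) (q (j + 1)) := by
    rcases mem_chainCurve_iff.1 hzH with rfl | h'
    · exact ⟨0, hm, left_mem_segment ℝ _ _⟩
    · exact h'
  obtain ⟨k, hk, hzk⟩ := hzV'
  obtain ⟨j, hj, hzj⟩ := hzH'
  have hdual := dualEdge_eq_of_mem_segment_inter hδ (hvadj k hk) (hwadj j hj) hzk hzj
  exact (mem_dualConfig_iff.1 (hwopen j hj).1).2 _ (hvopen k hk).1 hdual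


/-! ### Measure bookkeeping -/

/-- `P_{1/2}` on `ℤ²` gives zero mass to non-lattice configurations. [folklore] -/
theorem measureReal_not_subset_edgeSet :
    (bondPercolation (zdGraph 2) half).real {ω | ¬ ω ⊆ (zdGraph 2).edgeSet} = 0 := by
  rw [measureReal_eq_zero_iff]
  exact ae_iff.1 (ae_subset_edgeSet (zdGraph 2) half)

/-- Monotonicity of `P_{1/2}`-mass along an inclusion that holds for lattice configurations.
[folklore] -/
theorem measureReal_le_of_subset_lattice {A B : Set (BondConfig (Site 2))}
    (h : ∀ ω, ω ⊆ (zdGraph 2).edgeSet → ω ∈ A → ω ∈ B) :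
    (bondPercolation (zdGraph 2) half).real A ≤ (bondPercolation (zdGraph 2) half).real B := by
  have hsub : A ⊆ B ∪ {ω | ¬ ω ⊆ (zdGraph 2).edgeSet} := by
    intro ω hω
    by_cases hl : ω ⊆ (zdGraph 2).edgeSet
    · exact Or.inl (h ω hl hω)
    · exact Or.inr hl
  calc (bondPercolation (zdGraph 2) half).real A
      ≤ (bondPercolation (zdGraph 2) half).real (B ∪ {ω | ¬ ω ⊆ (zdGraph 2).edgeSet}) :=
        measureReal_mono hsub
    _ ≤ (bondPercolation (zdGraph 2) half).real B +
          (bondPercolation (zdGraph 2) half).real {ω | ¬ ω ⊆ (zdGraph 2).edgeSet} :=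
        measureReal_union_le _ _
    _ = (bondPercolation (zdGraph 2) half).real B := by rw [measureReal_not_subset_edgeSet, add_zero]

/-- **Self-duality of `P_{1/2}` on `ℤ²`**, event form: the dual configuration lies in a measurable
event with the same probability as the configuration itself (`bondPercolation_map_dualConfig_holds`,
`1 - 1/2 = 1/2`). [folklore] -/
theorem measureReal_preimage_dualConfig {A : Set (BondConfig (Site 2))} (hA : MeasurableSet A) :
    (bondPercolation (zdGraph 2) half).real (dualConfig ⁻¹' A) =
      (bondPercolation (zdGraph 2) half).real A := by
  have hs : unitInterval.symm half = half := Subtype.ext (by simp [half]; norm_num)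
  simp only [Measure.real]
  rw [← Measure.map_apply measurable_dualConfig hA, bondPercolation_map_dualConfig_holds half, hs]

/-- If `E ∩ D` contains no lattice configuration then `P(E) ≤ 1 - P(D)` (`D` measurable).
[folklore] -/
theorem measureReal_le_one_sub {E D : Set (BondConfig (Site 2))} (hD : MeasurableSet D)
    (h : ∀ ω, ω ⊆ (zdGraph 2).edgeSet → ω ∈ E → ω ∈ D → False) :
    (bondPercolation (zdGraph 2) half).real E ≤ 1 - (bondPercolation (zdGraph 2) half).real D := by
  have h1 : (bondPercolation (zdGraph 2) half).real E ≤ (bondPercolation (zdGraph 2) half).real Dᶜ :=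
    measureReal_le_of_subset_lattice fun ω hl hE hD' => h ω hl hE hD'
  rw [measureReal_compl hD, probReal_univ] at h1
  exact h1

/-! ### Small numerical facts -/

/-- `√2 ≤ 2` and `1 ≤ √2`. [folklore] -/
theorem one_le_sqrt_two_and : 1 ≤ Real.sqrt 2 ∧ Real.sqrt 2 ≤ 2 := by
  constructor
  · rw [show (1 : ℝ) = Real.sqrt 1 by simp]
    exact Real.sqrt_le_sqrt (by norm_num)
  · nlinarith [Real.sq_sqrt (show (0 : ℝ) ≤ 2 by norm_num), Real.sqrt_nonneg 2]

/-- The scaled standard position `δ · √2 (v₀ + i v₁)` as `(δ√2) · (v₀ + i v₁)`. [folklore] -/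
theorem mul_z_eq (δ : ℝ) (v : Site 2) :
    (δ : ℂ) * squareLatticeEmbedding.z v = ((δ * Real.sqrt 2 : ℝ) : ℂ) * Site.toComplex v := by
  rw [squareLatticeEmbedding_z]; push_cast; ring

/-- Face centre versus vertex: `dist (δ c w) (δ z w) = δ`. [folklore] -/
theorem dist_mul_c_mul_z {δ : ℝ} (hδ : 0 ≤ δ) (w : Site 2) :
    dist ((δ : ℂ) * squareLatticeEmbedding.c w) ((δ : ℂ) * squareLatticeEmbedding.z w) = δ := by
  rw [dist_eq_norm, squareLatticeEmbedding_c, squareLatticeEmbedding_z]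
  have e : (δ : ℂ) * (Real.sqrt 2 * (Site.toComplex w + (1 + I) / 2)) -
      (δ : ℂ) * (Real.sqrt 2 * Site.toComplex w) = (δ : ℂ) * (Real.sqrt 2 * ((1 + I) / 2)) := by ring
  rw [e, norm_mul, Complex.norm_real, Real.norm_eq_abs, abs_of_nonneg hδ]
  have h2 : ‖(Real.sqrt 2 : ℂ) * ((1 + I) / 2)‖ = 1 := by
    rw [norm_mul, Complex.norm_real, Real.norm_eq_abs, abs_of_nonneg (Real.sqrt_nonneg 2),
      norm_div, Complex.norm_two]
    have h11 : ‖(1 : ℂ) + I‖ = Real.sqrt 2 := by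
      rw [Complex.norm_eq_sqrt_sq_add_sq]; norm_num
    rw [h11]
    have := Real.mul_self_sqrt (show (0 : ℝ) ≤ 2 by norm_num)
    field_simp
    linarith
  rw [h2, mul_one]

/-- The mesh change `δ ↦ δ√2/a` tends to `0⁺` with `δ`. [folklore] -/
theorem tendsto_mesh_change {a : ℝ} (ha : 0 < a) :
    Tendsto (fun δ : ℝ => δ * Real.sqrt 2 / a) (𝓝[>] 0) (𝓝[>] 0) := by
  refine tendsto_nhdsWithin_of_tendsto_nhds_of_eventually_within _ ?_ ?_
  · have : Tendsto (fun δ : ℝ => δ * Real.sqrt 2 / a) (𝓝 0) (𝓝 (0 * Real.sqrt 2 / a)) :=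
      ((continuous_id.mul continuous_const).div_const a).tendsto 0
    rw [zero_mul, zero_div] at this
    exact this.mono_left nhdsWithin_le_nhds
  · filter_upwards [self_mem_nhdsWithin] with δ hδ
    exact div_pos (mul_pos hδ (Real.sqrt_pos.2 (by norm_num))) ha


end Summit.CriticalPhenomena.CardyFormulaZ2.Theorems.CardyIKTransport.RenewalGridHarmless

end
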